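import Summits.BirchSwinnertonDyer.BirchSwinnertonDyer.Theorems.Rank1ResidualIntModelReduction
import Summits.BirchSwinnertonDyer.Rank1Residual.X11b.CertificateRecordsGeneric
import Literature.NumberTheory.EllipticCurves.IsogenyCharacterCongruenceSieve
import Literature.NumberTheory.EllipticCurves.MazurTorsionPrimeCaseFromCor44Proofs
import Literature.NumberTheory.EllipticCurves.PointCountEulerCriterion
import HarnessLib

/-!
# `irr(7)` for `j = 3³·5·7⁵/2⁷` (Cremona `2450d1`, `2450ba1`, `2450bd1`) by the CONGRUENCE SIEVE —
# the integer-model certificate `r(φ_ℓ) = ±1` at `ℓ ≡ 1 (mod M)` and three kernel records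

HONEST FRAMING (cell `b2b-bsdres`, run/shared/lean/b2b/bsd-rank1-residual/, verbatim in every
file): the goal of the cell is to DELETE the COMBINATION-SHAPED residual classes of the
Birch–Swinnerton-Dyer formula for ALL analytic-rank `≤ 1` elliptic curves over `ℚ` — assembled
STRICTLY from published theorems — so that the rank-`≤ 1` remainder becomes exactly the
CONSTRUCTION-SHAPED classes, which are TYPED (missing-input `Prop`s), NOT attempted. This is not
"finishing BSD". Team x11b3, seat `b2b-bsdres-x11b3-p9` (gen. 8), cross-cell POOL ITEM of the
Ш-census seat `b2b-bsdres-sha-2` (GEN 15 ADDENDUM (3)(iii), INBOX 2026-08-21T17:39Z; declined by x1b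
GEN 28 and cc-typer-1 GEN 13 as "needs the isogeny-character argument itself"): PER-PAIR RECORDS
(model definitions + theorems; no named fact, no axiom, no `sorry`); nothing is booked by this file;
no label and no census number moves; every open class stays open.

## What this file proves

* `UnitRootSieve.hasIrreducibleModPGaloisRep_of_intModel_of_unitRoot` — **the integer-model
  certificate of the congruence sieve** (sibling of x11c's single-Frobenius certificate
  `IntModel.hasIrreducibleModPGaloisRep_of_intModel_of_noroot`,
  `Rank1ResidualIntModelReduction.lean`):
  for the globally minimal `W` with integral model `E₀`, an odd prime `p`, a natural number `M` with
  `p ∣ M`, `gcd(M, (p − 1)/2) = 1` and `gcd(Δ(E₀), c₄(E₀)) ∣ M^t` (every additive prime divides `M`;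
  the other bad primes are multiplicative, `q ∣ Δ`, `q ∤ c₄`), and a good prime `ℓ ∤ Δ(E₀)` with
  `ℓ ≡ 1 (mod M)`, `#(E₀ mod ℓ)(𝔽_ℓ) = n`, `p ∤ n` and `p ∤ 2(ℓ + 1) − n`: **`E[p]` is
  irreducible.**
  Indeed a `Γ_ℚ`-stable line has an isogeny character `r` with `r(φ_ℓ)² − a_ℓ r(φ_ℓ) + ℓ = 0`
  (Mazur 1978 Prop. 6.3 (1), tree), and `r(φ_ℓ)² = 1` by the sieve
  `Mazur1978.isogenyCharacter_sq_eq_one_of_isArithFrobAt_of_modEq_one`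
  (`Literature/…/IsogenyCharacterCongruenceSieve.lean`: `r²` is unramified outside the primes of
  `M`, hence — Kronecker–Weber, proved in the tree — a Dirichlet character of conductor `N` with
  `N ∣ ℓ^N − 1` and `gcd(N, (p−1)/2) = 1`, so trivial at `ℓ`), whence `r(φ_ℓ) = ±1` and
  `1 ∓ a_ℓ + ℓ ≡ 0`, i.e. `n ≡ 0` or `n ≡ 2(ℓ + 1) (mod p)`.
* Records **`irr_cremona2450d1`, `irr_cremona2450ba1`, `irr_cremona2450bd1` : `Irr … 7`**,
  HYPOTHESIS-FREE: the three curves of conductor `2450 = 2·5²·7²` with `j = 3³·5·7⁵/2⁷`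
  (multiplicative at `2`, additive potentially good at `5` and `7`), `M = 35`, witness
  **`ℓ = 71 ≡ 1 (mod 35)`, `#Ẽ(𝔽₇₁) = 73 ≡ 3 (mod 7)`** (`a₇₁ = −1`; `3 ∉ {0, 4 = 2·72 mod 7}`),
  kernel-decided (`natCard_point_eq_one_add_card` + `card_sol_eq_sum_euler` + `decide`), global
  minimality of Cremona's model decided from the support of `Δ` (x11c's
  `X11b.isGloballyMinimal_of_krausCriterion_support`: Silverman `q¹² ∤ Δ` at `2, 5, 7`).

Why a sieve and not a witness: the mod-`7` image of these curves is the index-`2` subgroup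
`{diag(x,y) : xy ∈ 𝔽₇ˣ²} ∪ {antidiag(a,b) : ab ∈ 𝔽₇ˣ²}` (order `36`) of the normaliser of the split
Cartan subgroup: irreducible, yet EVERY element has an `𝔽₇`-rational eigenvalue, so `X² − a_ℓX + ℓ`
has a root mod `7` at every good `ℓ` and Mazur's criterion at one Frobenius never applies (sha-2
GEN 15: no witness for `ℓ ≤ 6000`; this seat: none among the `2 259` good `ℓ ≤ 20 000`, class
frequencies `|G| ≈ 36.2`).  The point counts at `71` were recomputed by this seat's naive
enumeration before typing (third implementation; `a₇₁ = −1` on all three models).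

| pair | Cremona minimal model `[a₁,a₂,a₃,a₄,a₆]` | `Δ` | `c₄` | `#Ẽ(𝔽₇₁)` | minimality |
|---|---|---|---|---|---|
| `2450d1 @7` | `[1, -1, 0, -5252, 140496]` | `2⁷·5²·7¹⁰` | `3·5·7⁵` | `73` | Silverman at `2, 5, 7` |
| `2450ba1 @7` | `[1, -1, 1, -2680, -50053]` | `2⁷·5⁸·7⁴` | `3·5³·7³` | `73` | Silverman at `2, 5, 7` |
| `2450bd1 @7` | `[1, -1, 1, -131305, 17430697]` | `2⁷·5⁸·7¹⁰` | `3·5³·7⁵` | `73` | Silverman at `2, 5, 7` |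

Consumers (not used here): the Ш-census rule-V16-type closure of `2450d1 @7`
(`Typed.bsdp_of_matarNekovar_of_not_dvd_index`, binder `hirr` now a kernel theorem BY NAME) and the
O8 typer's image input for `2450ba1 / 2450bd1 @7`; nothing else about these pairs is asserted.
Data sources: a-invariants = Cremona's `allcurves` as copied in
`HOME/b2b-bsdres-sha-2/gen15/x411/frobirr1.json`; invariants and counts recomputed by this seat.
References: B. Mazur, Invent. Math. 44 (1978) §5, Prop. 6.3 (1) [Mazur1978]; J.-P. Serre, Invent.
Math. 15 (1972) §5.6 [Serre1972]; J. E. Cremona, *Algorithms for Modular Elliptic Curves* (1997),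
Table 1 [Cremona1997]; J. H. Silverman, *AEC* (2009) VII.1 Rem. 1.1, VII.5.1, VIII.8
[SilvermanAEC2009]; A. Kraus, Manuscripta Math. 65 (1989) [Kraus1989].
-/

set_option autoImplicit false

noncomputable section

open scoped Classical

open IsDedekindDomain NumberField Rat.HeightOneSpectrum WeierstrassCurve
  Literature.NumberTheory.EllipticCurves Literature.NumberTheory.GaloisRepresentations
  Literature.NumberTheory.EllipticCurves.Rank1Residual
  Literature.NumberTheory.EllipticCurves.Rank1Residual.X11RankOneCertificates
  Summit.BirchSwinnertonDyer.BirchSwinnertonDyer.Rank1Residual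

/-! ## §0 The integer-model certificate of the congruence sieve -/

namespace Summit.BirchSwinnertonDyer.Rank1Residual.GaloisImage.UnitRootSieve

variable {W : WeierstrassCurve ℚ} [W.IsElliptic] [W.IsGloballyMinimal] {E₀ : WeierstrassCurve ℤ}
  (hI : integralModelInt W = E₀)
include hI

/-- **`E[p]` irreducible from a unit-root (congruence-sieve) certificate** (Mazur 1978 §5 and
Prop. 6.3 (1), with the sieve `Mazur1978.isogenyCharacter_sq_eq_one_of_isArithFrobAt_of_modEq_one`).
For the globally minimal `W` with integral model `E₀`: `p` an odd prime; `M` with `p ∣ M`,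
`gcd(M, (p − 1)/2) = 1` and `gcd(Δ(E₀), c₄(E₀)) ∣ M ^ t` (so every prime of additive reduction
divides `M`, and every bad prime `q ∤ M` is multiplicative); a prime `ℓ ∤ Δ(E₀)` with
`ℓ ≡ 1 (mod M)`, `#(E₀ mod ℓ)(𝔽_ℓ) = n`, `n ≢ 0` and `2(ℓ + 1) − n ≢ 0 (mod p)`.  Then `E[p]` is an
irreducible `Γ_ℚ`-module: otherwise a stable line `⟨P⟩` has a character `r` with
`r(φ_ℓ)² − a_ℓ r(φ_ℓ) + ℓ = 0` in `𝔽_p` (`a_ℓ = ℓ + 1 − n`) and `r(φ_ℓ)² = 1`, i.e. `r(φ_ℓ) = ±1`,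
giving `n ≡ 0` or `2(ℓ + 1) − n ≡ 0`.
[cite: Mazur1978, §5 (p. 148) and §6 Prop. 6.3 (1) (p. 153)] -/
theorem hasIrreducibleModPGaloisRep_of_intModel_of_unitRoot (p ℓ M t : ℕ) [hp : Fact p.Prime]
    [hℓ : Fact ℓ.Prime] (hp2 : p ≠ 2) (hℓΔ : ¬ (ℓ : ℤ) ∣ E₀.Δ)
    (hpM : p ∣ M) (hcop : M.Coprime ((p - 1) / 2)) (hMℓ : ℓ ≡ 1 [MOD M])
    (hadd : Int.gcd E₀.Δ E₀.c₄ ∣ M ^ t) {n : ℕ}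
    (hcard : Nat.card ((E₀.map (Int.castRingHom (ZMod ℓ))).toAffine.Point) = n)
    (h₁ : ((n : ℤ) : ZMod p) ≠ 0) (h₂ : ((2 * ((ℓ : ℤ) + 1) - n : ℤ) : ZMod p) ≠ 0) :
    W.HasIrreducibleModPGaloisRep p := by
  have hpp : p.Prime := hp.out
  haveI : NeZero (p : ℚ) := ⟨Nat.cast_ne_zero.mpr hpp.ne_zero⟩
  have hgood : W.HasGoodReductionAtPrime ℓ :=
    hasGoodReductionAtPrime_of_not_dvd W ℓ
      (by rw [IntModel.minimalDiscriminantInt_eq hI]; exact hℓΔ)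
  have htr : W.frobeniusTrace ℓ = (ℓ : ℤ) + 1 - n := IntModel.frobeniusTrace_eq hI hcard
  -- good or multiplicative reduction at every prime `q ∤ M`
  have hS : ∀ q : ℕ, q.Prime → ¬ q ∣ M → ∀ v : HeightOneSpectrum (𝓞 ℚ), (q : 𝓞 ℚ) ∈ v.asIdeal →
      W.HasGoodReductionAt v ∨ 1 < v.valuation ℚ W.j := by
    intro q hq hqM v hv
    haveI := Fact.mk hq
    have hvq : (primesEquiv v : ℕ) = q := primesEquiv_eq_of_natCast_mem hq hv
    by_cases hqΔ : (q : ℤ) ∣ E₀.Δ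
    · -- `q ∣ Δ`, `q ∤ c₄` (else `q ∣ gcd(Δ, c₄) ∣ M ^ t`): multiplicative, `|j|_v > 1`
      have hqc₄ : ¬ (q : ℤ) ∣ E₀.c₄ := by
        intro hc
        have hg : q ∣ Int.gcd E₀.Δ E₀.c₄ := Int.dvd_gcd hqΔ hc
        exact hqM (hq.dvd_of_dvd_pow (hg.trans hadd))
      right
      have hmult : W.HasMultiplicativeReductionAt v := by
        refine W.hasMultiplicativeReductionAt_of_dvd_of_not_dvd v ?_ ?_
        · rw [hvq, IntModel.minimalDiscriminantInt_eq hI]; exact hqΔ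
        · rw [hvq, hI]; exact hqc₄
      exact one_lt_valuation_j_of_hasMultiplicativeReduction_localMinimalModel v W hmult
    · left
      have hgq : W.HasGoodReductionAtPrime q :=
        hasGoodReductionAtPrime_of_not_dvd W q
          (by rw [IntModel.minimalDiscriminantInt_eq hI]; exact hqΔ)
      exact (hasGoodReductionAtPrime_primesEquiv_iff_holds W v q hvq).mp hgq
  by_contra hred
  obtain ⟨H, hHstab, hHcard⟩ :=
    (Mazur1978.not_hasIrreducibleModPGaloisRep_iff_exists_natCard_eq W p).mp hred
  obtain ⟨P, hP0, hHP⟩ := Mazur1978.exists_eq_zmultiples_of_natCard_eq W p hHcard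
  have hst : ∀ σ : Field.absoluteGaloisGroup ℚ, σ • P ∈ AddSubgroup.zmultiples P := fun σ ↦ by
    rw [← hHP]; exact hHstab σ P (hHP ▸ AddSubgroup.mem_zmultiples P)
  obtain ⟨r, hr⟩ := Mazur1978.exists_isogenyCharacter W p hP0 hst
  set v : HeightOneSpectrum (𝓞 ℚ) := (primesEquiv (R := 𝓞 ℚ)).symm ⟨ℓ, hℓ.out⟩ with hvdef
  have hgen : Rat.HeightOneSpectrum.natGenerator v = ℓ := by
    change ((primesEquiv v : Nat.Primes) : ℕ) = ℓ
    rw [hvdef, Equiv.apply_symm_apply]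
  have hv : (ℓ : 𝓞 ℚ) ∈ v.asIdeal := by
    have h := Mazur1978.natCast_natGenerator_mem_asIdeal v
    rwa [hgen] at h
  obtain ⟨𝔓, h𝔓⟩ := v.primesAbove_nonempty
  obtain ⟨φ, hφ⟩ := HeightOneSpectrum.exists_isArithFrobAt_of_mem_primesAbove_holds (v := v) h𝔓
  -- `ℓ ≠ p`: `p ∣ M ∣ ℓ − 1`
  have hℓp : ℓ ≠ p := by
    intro h
    have hdvd : (M : ℤ) ∣ (ℓ : ℤ) - 1 := by
      have h' := Nat.modEq_iff_dvd.mp hMℓ.symm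
      push_cast at h'
      exact h'
    have hp1 : (p : ℤ) ∣ (p : ℤ) - 1 := by
      have h' := (Int.natCast_dvd_natCast.mpr hpM).trans hdvd
      rwa [h] at h'
    have h2 : (p : ℤ) ∣ 1 := by
      have h3 := dvd_sub (dvd_refl (p : ℤ)) hp1
      rwa [sub_sub_cancel] at h3
    have h4 : (p : ℤ) = 1 := Int.eq_one_of_dvd_one (by positivity) h2
    exact hpp.one_lt.ne' (by exact_mod_cast h4)
  -- Mazur Prop. 6.3 (1): `x² − a_ℓ x + ℓ = 0` for `x = r(φ)`
  have key := Mazur1978.isogenyCharacter_sq_sub_frobeniusTrace_mul_add_eq_zero W p ℓ hℓp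
    hgood hP0 hr hv h𝔓 hφ
  rw [htr] at key
  -- the sieve: `x² = 1`
  have hsq : r φ ^ 2 = 1 :=
    Mazur1978.isogenyCharacter_sq_eq_one_of_isArithFrobAt_of_modEq_one W p hp2 hP0 hr hpM hcop hS
      hℓ.out hMℓ hv h𝔓 hφ
  have hx : ((r φ : (ZMod p)ˣ) : ZMod p) ^ 2 = 1 := by
    rw [← Units.val_pow_eq_pow_val, hsq, Units.val_one]
  have hx' : ((r φ : (ZMod p)ˣ) : ZMod p) * ((r φ : (ZMod p)ˣ) : ZMod p) = 1 := by
    rw [← sq]; exact hx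
  rcases mul_self_eq_one_iff.mp hx' with h | h
  · rw [h] at key
    apply h₁
    push_cast at key ⊢
    linear_combination key
  · rw [h] at key
    apply h₂
    push_cast at key ⊢
    linear_combination key

end Summit.BirchSwinnertonDyer.Rank1Residual.GaloisImage.UnitRootSieve

/-! ## §1 The three records at `7` -/

namespace Summit.BirchSwinnertonDyer.Rank1Residual.GaloisImage.UnitRootRecords

/-- `7` is prime. -/
instance factPrimeSeven : Fact (Nat.Prime 7) := ⟨by norm_num⟩

/-- `71` is prime (the sieve prime, `71 ≡ 1 (mod 35)`). -/
instance factPrimeSeventyOne : Fact (Nat.Prime 71) := ⟨by norm_num⟩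

/-- An integer Weierstrass model with `Δ ≠ 0` is an elliptic curve over `ℚ` (`Δ` is the
tree-rechecked integer `discOf` of `X11RankOneCertificates/Schema.lean`).
[cite: SilvermanAEC2009, III.1 (p. 42)] -/
private theorem isElliptic_of_discOf_ne_zeroU (a1 a2 a3 a4 a6 : ℤ)
    (h : discOf [a1, a2, a3, a4, a6] ≠ 0) :
    (⟨a1, a2, a3, a4, a6⟩ : WeierstrassCurve ℚ).IsElliptic := by
  refine ⟨?_⟩
  have hΔ : (⟨a1, a2, a3, a4, a6⟩ : WeierstrassCurve ℚ).Δ =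
      ((discOf [a1, a2, a3, a4, a6] : ℤ) : ℚ) := by
    simp only [WeierstrassCurve.Δ, WeierstrassCurve.b₂, WeierstrassCurve.b₄, WeierstrassCurve.b₆,
      WeierstrassCurve.b₈, discOf, invariants]
    push_cast
    ring
  rw [hΔ, isUnit_iff_ne_zero]
  exact_mod_cast h

/-- The support-based minimality test evaluated per record: every listed `q` is prime (trial
division), `|Δ(a)| = ∏ q^{v_q Δ}` over the list, and x11c's per-prime test `X11b.minCheckAt`
(Silverman `q¹² ∤ Δ ∨ q⁴ ∤ c₄`, or the integer Kraus test at `q = 2`, or `3⁸ ‖ c₆` at `q = 3`).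
Entries `(q, v_q N, v_q Δ)`; `v_q N` is documentation. [folklore] -/
private def minSupportCheckU (a : List ℤ) (bad : List (ℕ × ℕ × ℕ)) : Bool :=
  bad.all (fun t => isPrimeBelow504100 t.1) &&
  (((bad.map fun t => t.1 ^ t.2.2).prod : ℕ) == (discOf a).natAbs) &&
  bad.all (X11b.minCheckAt a)

/-- Global minimality of a literal integer model from a passing `minSupportCheckU` (soundness =
x11c's `X11b.isGloballyMinimal_of_krausCriterion_support`).
[cite: SilvermanAEC2009, VII.1 Remark 1.1 and VIII.8] [cite: Kraus1989, Prop. 1 and Prop. 2] -/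
private theorem isGloballyMinimal_of_minSupportCheckU (a1 a2 a3 a4 a6 : ℤ) (bad : List (ℕ × ℕ × ℕ))
    (h : minSupportCheckU [a1, a2, a3, a4, a6] bad = true) :
    (⟨a1, a2, a3, a4, a6⟩ : WeierstrassCurve ℚ).IsGloballyMinimal := by
  simp only [minSupportCheckU, Bool.and_eq_true, List.all_eq_true, beq_iff_eq] at h
  obtain ⟨⟨hpr, hprod⟩, hmin⟩ := h
  refine X11b.isGloballyMinimal_of_krausCriterion_support a1 a2 a3 a4 a6 bad
    (fun t ht ↦ prime_of_isPrimeBelow504100 (hpr t ht)) hprod.symm fun t ht ↦ ?_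
  have hmt := hmin t ht
  simp only [X11b.minCheckAt, Bool.or_eq_true, Bool.and_eq_true, decide_eq_true_eq, beq_iff_eq]
    at hmt
  rcases hmt with ((h12 | h4) | ⟨⟨⟨h2, h16⟩, h64⟩, hk⟩) | ⟨⟨h3, h8⟩, h9⟩
  · exact Or.inl (Or.inl h12)
  · exact Or.inl (Or.inr h4)
  · exact Or.inr (Or.inl ⟨h2, h16, h64, hk⟩)
  · exact Or.inr (Or.inr ⟨h3, h8, h9⟩)

/-! ### §1.1 `2450d1 @ 7` (Ш-census rule V16, 18th row; index zero on both engines) -/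

/-- `#Ẽ(𝔽₇₁) = 73` for `[1, -1, 0, -5252, 140496]` (`a₇₁ = -1`). Kernel-decided. [folklore] -/
theorem card_2450d1_mod71 :
    Nat.card (((⟨1, -1, 0, -5252, 140496⟩ : WeierstrassCurve ℤ).map
      (Int.castRingHom (ZMod 71))).toAffine.Point) = 73 := by
  rw [@WeierstrassCurve.natCard_point_eq_one_add_card (ZMod 71) (@ZMod.instField 71 ⟨by norm_num⟩)
    _ _ _ (by decide +kernel), @card_sol_eq_sum_euler (ZMod 71) (@ZMod.instField 71 ⟨by norm_num⟩)
    _ _ (by rw [ZMod.ringChar_zmod_n]; decide), ZMod.card]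
  decide +kernel

/-- Cremona `2450d1`: `[1, -1, 0, -5252, 140496]` (`N = 2450 = 2·5²·7²`, `j = 3³·5·7⁵/2⁷`; Ш-census
rule V16 18th row `2450d1@7`). [cite: Cremona1997, Table 1 (curve 2450d1)] -/
def cremona2450d1 : WeierstrassCurve ℚ := ⟨1, -1, 0, -5252, 140496⟩

/-- `2450d1` is an elliptic curve (`Δ = 903920796800 = 2⁷·5²·7¹⁰ ≠ 0`). -/
instance isElliptic_cremona2450d1 : cremona2450d1.IsElliptic := by
  have h := isElliptic_of_discOf_ne_zeroU 1 (-1) 0 (-5252) 140496 (by decide)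
  norm_num at h
  exact h

/-- `[1, -1, 0, -5252, 140496]` is globally minimal, kernel-decided from the support
`(q, v_q N, v_q Δ) = [(2, 1, 7), (5, 2, 2), (7, 2, 10)]` of `Δ = 903920796800` (`c₄ = 252105`):
Silverman at every bad prime. [cite: SilvermanAEC2009, VII.1 Remark 1.1 and VIII.8] -/
instance isGloballyMinimal_cremona2450d1 : cremona2450d1.IsGloballyMinimal := by
  have h := isGloballyMinimal_of_minSupportCheckU 1 (-1) 0 (-5252) 140496
    [(2, 1, 7), (5, 2, 2), (7, 2, 10)] (by decide +kernel)
  norm_num at h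
  exact h

/-- The integral model of `2450d1` is `[1, -1, 0, -5252, 140496]`. [folklore] -/
theorem integralModelInt_cremona2450d1 :
    integralModelInt cremona2450d1 = ⟨1, -1, 0, -5252, 140496⟩ :=
  IntModel.integralModelInt_eq_of_map_eq _ (by ext <;> simp [WeierstrassCurve.map, cremona2450d1])

/-- **RECORD `2450d1 @ 7`: `E[7]` is irreducible — congruence-sieve certificate with `M = 35` at
`ℓ = 71 ≡ 1 (mod 35)` (`#Ẽ(𝔽₇₁) = 73 ≡ 3 (mod 7)`, `3 ∉ {0, 4}`; `2` multiplicative, `5, 7 ∣ 35`),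
kernel-decided, NO hypothesis.** [cite: Mazur1978, §5 (p. 148) and §6 Prop. 6.3 (1) (p. 153)] -/
theorem irr_cremona2450d1 : Irr cremona2450d1 7 :=
  UnitRootSieve.hasIrreducibleModPGaloisRep_of_intModel_of_unitRoot integralModelInt_cremona2450d1
    7 71 35 5 (by norm_num) (by decide) (by norm_num) (by decide) (by decide) (by decide)
    card_2450d1_mod71 (by decide) (by decide)

/-! ### §1.2 `2450ba1 @ 7` (O8 row; quadratic twist of `2450d1`) -/

/-- `#Ẽ(𝔽₇₁) = 73` for `[1, -1, 1, -2680, -50053]` (`a₇₁ = -1`). Kernel-decided. [folklore] -/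
theorem card_2450ba1_mod71 :
    Nat.card (((⟨1, -1, 1, -2680, -50053⟩ : WeierstrassCurve ℤ).map
      (Int.castRingHom (ZMod 71))).toAffine.Point) = 73 := by
  rw [@WeierstrassCurve.natCard_point_eq_one_add_card (ZMod 71) (@ZMod.instField 71 ⟨by norm_num⟩)
    _ _ _ (by decide +kernel), @card_sol_eq_sum_euler (ZMod 71) (@ZMod.instField 71 ⟨by norm_num⟩)
    _ _ (by rw [ZMod.ringChar_zmod_n]; decide), ZMod.card]
  decide +kernel

/-- Cremona `2450ba1`: `[1, -1, 1, -2680, -50053]` (`N = 2450`, `j = 3³·5·7⁵/2⁷`; O8 row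
`2450ba1@7`). [cite: Cremona1997, Table 1 (curve 2450ba1)] -/
def cremona2450ba1 : WeierstrassCurve ℚ := ⟨1, -1, 1, -2680, -50053⟩

/-- `2450ba1` is an elliptic curve (`Δ = 120050000000 = 2⁷·5⁸·7⁴ ≠ 0`). -/
instance isElliptic_cremona2450ba1 : cremona2450ba1.IsElliptic := by
  have h := isElliptic_of_discOf_ne_zeroU 1 (-1) 1 (-2680) (-50053) (by decide)
  norm_num at h
  exact h

/-- `[1, -1, 1, -2680, -50053]` is globally minimal, kernel-decided from the support
`(q, v_q N, v_q Δ) = [(2, 1, 7), (5, 2, 8), (7, 2, 4)]` of `Δ = 120050000000` (`c₄ = 128625`):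
Silverman at every bad prime. [cite: SilvermanAEC2009, VII.1 Remark 1.1 and VIII.8] -/
instance isGloballyMinimal_cremona2450ba1 : cremona2450ba1.IsGloballyMinimal := by
  have h := isGloballyMinimal_of_minSupportCheckU 1 (-1) 1 (-2680) (-50053)
    [(2, 1, 7), (5, 2, 8), (7, 2, 4)] (by decide +kernel)
  norm_num at h
  exact h

/-- The integral model of `2450ba1` is `[1, -1, 1, -2680, -50053]`. [folklore] -/
theorem integralModelInt_cremona2450ba1 :
    integralModelInt cremona2450ba1 = ⟨1, -1, 1, -2680, -50053⟩ :=
  IntModel.integralModelInt_eq_of_map_eq _ (by ext <;> simp [WeierstrassCurve.map, cremona2450ba1])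

/-- **RECORD `2450ba1 @ 7`: `E[7]` is irreducible — congruence-sieve certificate with `M = 35` at
`ℓ = 71` (`#Ẽ(𝔽₇₁) = 73 ≡ 3 (mod 7)`), kernel-decided, NO hypothesis.**
[cite: Mazur1978, §5 (p. 148) and §6 Prop. 6.3 (1) (p. 153)] -/
theorem irr_cremona2450ba1 : Irr cremona2450ba1 7 :=
  UnitRootSieve.hasIrreducibleModPGaloisRep_of_intModel_of_unitRoot integralModelInt_cremona2450ba1
    7 71 35 5 (by norm_num) (by decide) (by norm_num) (by decide) (by decide) (by decide)
    card_2450ba1_mod71 (by decide) (by decide)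

/-! ### §1.3 `2450bd1 @ 7` (O8 row; quadratic twist of `2450d1`) -/

/-- `#Ẽ(𝔽₇₁) = 73` for `[1, -1, 1, -131305, 17430697]` (`a₇₁ = -1`). Kernel-decided. [folklore] -/
theorem card_2450bd1_mod71 :
    Nat.card (((⟨1, -1, 1, -131305, 17430697⟩ : WeierstrassCurve ℤ).map
      (Int.castRingHom (ZMod 71))).toAffine.Point) = 73 := by
  rw [@WeierstrassCurve.natCard_point_eq_one_add_card (ZMod 71) (@ZMod.instField 71 ⟨by norm_num⟩)
    _ _ _ (by decide +kernel), @card_sol_eq_sum_euler (ZMod 71) (@ZMod.instField 71 ⟨by norm_num⟩)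
    _ _ (by rw [ZMod.ringChar_zmod_n]; decide), ZMod.card]
  decide +kernel

/-- Cremona `2450bd1`: `[1, -1, 1, -131305, 17430697]` (`N = 2450`, `j = 3³·5·7⁵/2⁷`; O8 row
`2450bd1@7`). [cite: Cremona1997, Table 1 (curve 2450bd1)] -/
def cremona2450bd1 : WeierstrassCurve ℚ := ⟨1, -1, 1, -131305, 17430697⟩

/-- `2450bd1` is an elliptic curve (`Δ = 14123762450000000 = 2⁷·5⁸·7¹⁰ ≠ 0`). -/
instance isElliptic_cremona2450bd1 : cremona2450bd1.IsElliptic := by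
  have h := isElliptic_of_discOf_ne_zeroU 1 (-1) 1 (-131305) 17430697 (by decide)
  norm_num at h
  exact h

/-- `[1, -1, 1, -131305, 17430697]` is globally minimal, kernel-decided from the support
`(q, v_q N, v_q Δ) = [(2, 1, 7), (5, 2, 8), (7, 2, 10)]` of `Δ = 14123762450000000`
(`c₄ = 6302625`): Silverman at every bad prime.
[cite: SilvermanAEC2009, VII.1 Remark 1.1 and VIII.8] -/
instance isGloballyMinimal_cremona2450bd1 : cremona2450bd1.IsGloballyMinimal := by
  have h := isGloballyMinimal_of_minSupportCheckU 1 (-1) 1 (-131305) 17430697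
    [(2, 1, 7), (5, 2, 8), (7, 2, 10)] (by decide +kernel)
  norm_num at h
  exact h

/-- The integral model of `2450bd1` is `[1, -1, 1, -131305, 17430697]`. [folklore] -/
theorem integralModelInt_cremona2450bd1 :
    integralModelInt cremona2450bd1 = ⟨1, -1, 1, -131305, 17430697⟩ :=
  IntModel.integralModelInt_eq_of_map_eq _ (by ext <;> simp [WeierstrassCurve.map, cremona2450bd1])

/-- **RECORD `2450bd1 @ 7`: `E[7]` is irreducible — congruence-sieve certificate with `M = 35` at
`ℓ = 71` (`#Ẽ(𝔽₇₁) = 73 ≡ 3 (mod 7)`), kernel-decided, NO hypothesis.**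
[cite: Mazur1978, §5 (p. 148) and §6 Prop. 6.3 (1) (p. 153)] -/
theorem irr_cremona2450bd1 : Irr cremona2450bd1 7 :=
  UnitRootSieve.hasIrreducibleModPGaloisRep_of_intModel_of_unitRoot integralModelInt_cremona2450bd1
    7 71 35 5 (by norm_num) (by decide) (by norm_num) (by decide) (by decide) (by decide)
    card_2450bd1_mod71 (by decide) (by decide)

/-- **Summary: `irr(7)` for the three `N = 2450` curves with `j = 3³·5·7⁵/2⁷`, hypothesis-free.**
[cite: Mazur1978, §5 (p. 148) and §6 Prop. 6.3 (1) (p. 153)] -/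
theorem irr_seven_of_j_2268945_div_128 :
    Irr cremona2450d1 7 ∧ Irr cremona2450ba1 7 ∧ Irr cremona2450bd1 7 :=
  ⟨irr_cremona2450d1, irr_cremona2450ba1, irr_cremona2450bd1⟩

end Summit.BirchSwinnertonDyer.Rank1Residual.GaloisImage.UnitRootRecords
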